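import Literature.Probability.MarkovChains.TotalVariation
import HarnessLib

/-!
# Frugal rejection sampling: how many probabilities per sampled bitstring (Markov–Fatima–Isakov–Boixo 2018, §4)

Topic `Literature/Computability/QuantumComplexity` (pub-qadeq lane).  The classical-cost cells of the
random-circuit-sampling rows convert "cost of ONE output probability / amplitude" into "cost of
SAMPLING ℓ bitstrings" through one device, frugal rejection sampling, and its constant `≈ 10`:
CLAIMS E-01 (Arute et al. 2019, Supplementary Information, classical-simulation section (qFlex
paragraph), arXiv:1910.11333 tex chunk p0032 L16–17: "a set of random
output bitstrings is chosen before the computation starts. Then, the amplitudes for these bitstrings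
are computed and either accepted or rejected using frugal rejection sampling [Markov et al. 2018].
This ensures that the selected subset of bitstrings is indistinguishable from bitstrings sampled
from a quantum computer. The cost of the TN simulation is therefore linear in the number of output
bitstrings"; L35: "Fast sampling technique: the overhead in applying the frugal rejection sampling
mentioned above is removed by this technique, giving an order of magnitude speedup [Villalonga et
al. 2019]"), E-04 (Morvan et al. 2024, main text p. 6: "sampling 1 million uncorrelated bitstrings
… requires the computation of 10 million approximate probability amplitudes … rejection sampling
[22]"; SI App. G p. 26: "The frugal rejection sampling proposed in Ref. [15] requires computing only
about 10 probabilities per output bitstring sampled"), the E-01 challengers (Huang et al. 2020,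
arXiv:2005.06787 tex chunk p0006: "performing rejection sampling on single amplitude calculations leads to an
approximately 10× overhead"; Villalonga et al. 2019 §4.3: "needs the numerical computation of
`10 × 10⁶ = 10⁷` amplitudes … due to the acceptance of `1/M` amplitudes (on average) of the rejection
sampling, where `M = 10` when sampling from a given Porter-Thomas distribution with statistical
distance `ε` of the order of `10⁻⁴`"), and the review [HangleiterEisert2023].

HONEST FRAMING: instance-level adjudication of specific advantage claims; no claim about BQP vs BPP
or the summit.  Finite identities and inequalities about a sampling procedure GIVEN exact
probabilities `p(x)`; nothing here says what any circuit's output distribution is, that it is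
Porter–Thomas, or what computing one `p(x)` costs.

## Source (verbatim)

[MarkovEtAl2018] I. L. Markov, A. Fatima, S. V. Isakov, S. Boixo, *Quantum Supremacy Is Both Closer
and Farther than It Appears*, arXiv:1807.10749 (2018), §4 "How many amplitudes must be calculated?"
(tex source, `lit read arxiv:1807.10749` chunk p0008).  ¶"Basic rejection sampling": "A quantum
computer running an `n`-qubit circuit … may yield any one of `N = 2ⁿ` bitstrings on the output.
However, outcome probabilities `{p(x_j)}` for sufficiently deep circuits follow an exponential
(Porter-Thomas) form `(1/N) Σ_x δ(p(x) − p) = N e^{−Np}` … a competing classical computer might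
select a bitstring `x_j` uniformly at random, calculate its probability `p(x_j)` by simulation, and
accept `x_j` with probability `p(x_j)N/M ≤ 1`, repeating the entire process until acceptance. This
rejection sampling assumes a bound `M ≥ max_x p(x) N` and requires an average of `M` probabilities
`p(x)` per accepted bitstring. … We can estimate the expected number `ε` of probabilities
`p(x) > M/N` using the Porter-Thomas distribution as follows
`Exp[Σ_{p(x) ≥ M/N} 1] = ε = N ∫_M^∞ e^{−t} dt = N e^{−M}`.  Hence for given `ε` we can choose
`M = ln(N/ε)`. For `ε = 10⁻³` and `n = 49`, we need `M = ⌈ln(10³ 2⁴⁹)⌉ = 41` probabilities per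
bitstring."  ¶"Frugal rejection sampling": "To reduce the number `M` of probabilities per output
bistring to `M′` without significantly increasing the error, we set `M′(ε)` so that
`Σ_{x : p(x) > M′/N} p(x) ≤ ε`. The distribution `p̃(x)` from which Algorithm 1 samples has
statistical variational distance from the true distribution
`½ Σ_x |p(x) − p̃(x)| = Exp[Σ_{x : p(x) > M′/N} p(x)] ≤ ε`. To get a tight bound on the number of
probabilities needed per bitstring, we use Porter-Thomas statistics
`Exp[Σ_{x : p(x) > M′/N} p(x)] = ∫_{M′}^∞ t e^{−t} dt = e^{−M′}(1 + M′)`. The statistical distance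
decreases exponentially with the number of probabilities `M′` per bitstring sample. `M′ = 10` gives
statistical distance equal to `ε = 5·10⁻⁴`, independent of the number of qubits. To further
decrease `ε`, we skip Step 4 in Algorithm 1 … and always accept `x_j` when `p(x_j) ≥ M′/N` in
Step 4 in Algorithm 2. In other words, instead of ignoring high-probability bitstrings, we sample
them with a lower probability. Extending earlier calculations gives
`½ Σ_x |p(x) − p̃(x)| = 2 exp(−M′/(1 − e^{−M′}))`. For `M′ = 10`, this reduces the statistical
distance … to `9·10⁻⁵`. Our frugal rejection-sampling can be applied without assuming
Porter-Thomas statistics. For such uses, one cannot rely on analytical error bounds, but can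
calculate the sampling error (for a given `M′`) for each batch of `ℓM′` probability values."
Abstract of §4: "Our frugal rejection sampling yields `ℓ` bistrings from the appropriate
distribution (on average) using only `10ℓ` output probabilities."

[HangleiterEisert2023] D. Hangleiter, J. Eisert, Rev. Mod. Phys. 95, 035001 (2023), section on
classical simulation, ¶ on sampling (arXiv:2206.04079 tex chunks p0063 L16–21, p0064 L18–26): "The
idea of rejection sampling is to generate a sample `y` from a distribution `q` … it must satisfy
`p(x) ≤ c q(x)` … the sample `x` is accepted if `u c q(x) ≤ p(x)` and rejected otherwise. … The
expected number of probabilities that need to be computed per sample is given by `c`. … Choosing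
the uniform proposal distribution and the bound `c = log(2ⁿ/ε)` … one can therefore simulate
Porter-Thomas distributed probability distributions for `n = 49` up to error `ε = 10⁻³` using `41`
probabilities per bit string on average. … frugal rejection sampling chooses `c` such that the
upper tail of the distribution with probabilities `> c/2ⁿ` has fixed weight `ε` and accepts all
proposed strings `x_j` with unit probability if [`2ⁿ p(x_j) > c`]. This effectively reduces the
probability of such outcomes to `c/2ⁿ` and improves the average number of probabilities required
per sample and makes them independent of `n`. At the same time, it introduces an error …
Quantitatively, this error is given by `2 exp(−c/(1 − e^{−c}))` as measured by the TVD of the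
sampled distribution to the ideal one assuming exponentially distributed probabilities."

[VillalongaEtAl2019] B. Villalonga et al., npj Quantum Inf. 5, 86 (2019) = arXiv:1811.09599, §4.3
"Fast sampling of bit-strings from low fidelity RQCs" (tex chunks p0016 L80–p0017 L10, p0017
L38–56): "we accept a bit-string `s_ABC` with probability `min[1, p(s_ABC)N/M]` … Given an `M` and
a batch size `N_C`, the probability that a bit-string is accepted from a batch is (on average)
`1 − (1 − 1/M)^{N_C}`. For `M = 10` and `N_C = 30`, the probability of acceptance in a batch is
`95.76%` … for `M = 10` and `N_C = 60`, the probability goes up to `99.82%`"; "We can estimate the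
error in sampling numerically … as the sum of the probability amplitudes larger than `M/N` with `N`
being the dimension of the Hilbert space, multiplied by `N` and divided by the number of amplitudes
computed. For `M = 10`, we estimate an error `ε = 9.3×10⁻⁴` …".

## Dictionary and contents (all proved, 0 named facts)

`S` is the finite set of bitstrings, `N = |S|`, `p : S → ℝ` the target (`p ≥ 0`, `Σ p = 1` where
needed), `M > 0` the budget (`M` or `M′` of the source; `c` of the review); the threshold is `M/N`.
One ROUND = propose `x` uniformly (probability `1/N`), compute the one number `p(x)`, accept with
probability `a(x)`.

* `clipAccept M p x = min 1 (N p(x)/M)` — Algorithm 2's rule (= Villalonga's `min[1, p N/M]`, = the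
  basic rule `p(x)N/M` when `M ≥ N max p`); `skipAccept M p x` — Algorithm 1's rule (`p(x)N/M` if
  `N p(x) ≤ M`, else reject: "ignoring high-probability bitstrings").
* `roundWeight a x = a(x)/N` (propose `x` AND accept), `acceptRate a = Σ_x a(x)/N` (a round accepts),
  `outLaw a x = roundWeight a x / acceptRate a` — the law of the accepted string ("repeating the entire
  process until acceptance"); `outLaw_eq`: `= a(x)/Σ a`; `hasSum_rounds`: the number of rounds — of
  computed probabilities — until acceptance has mean `Σ_{n≥0} (n+1) α (1−α)ⁿ = 1/α`.
* Basic sampler: `outLaw_clip_basic` — under `M ≥ N max_x p(x)` the accepted string has law EXACTLY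
  `p`; `acceptRate_clip_basic` — a round accepts with probability `1/M`, so (`hasSum_rounds_basic`)
  "requires an average of `M` probabilities per accepted bitstring"; `pt_tailCount` — the printed
  Porter–Thomas count `N ∫_M^∞ e^{−t} dt = N e^{−M}`; `pt_tailCount_at_log` — "`M = ln(N/ε)`" makes
  it `ε`; `ceil_log_eq_41` — "`⌈ln(10³·2⁴⁹)⌉ = 41`"; `two_pow_49_mul_exp_neg_41_le` — then
  `N e^{−M} ≤ 10⁻³`.
* `tailMass M p = Σ_{x : N p(x) > M} p(x)` (the `ε` of the frugal paragraph), `tailCount`,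
  `tailMass_antitone` (a larger budget can only shrink it), `uniform_mean_tail_indicator`
  (Villalonga's estimator "sum of the amplitudes larger than `M/N` × `N` / #computed" is unbiased
  for it under uniform proposals).
* Algorithm 1: `acceptRate_skip` (`= (1 − ε)/M`), `outLaw_skip` (`p̃ = p·1[Np ≤ M]/(1 − ε)`) and
  **`tvDist_skip`** — `½ Σ |p − p̃| = Σ_{x : p(x) > M/N} p(x)` EXACTLY, for every `p` (the printed
  identity without the `Exp`, which in the source averages over circuits); `pt_tailMass` — the
  printed Porter–Thomas value `∫_{M′}^∞ t e^{−t} dt = (1 + M′) e^{−M′}` (`M′ ≥ 0`);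
  `pt_tailMass_antitone` ("decreases … with `M′`"); `eleven_mul_exp_neg_ten` — at `M′ = 10` it lies
  in `(4.99·10⁻⁴, 5·10⁻⁴)` ("`ε = 5·10⁻⁴`").
* Algorithm 2: `clipMass M p = Σ_x min(p(x), M/N)` (`Z′`), `acceptRate_clip` (`= Z′/M`),
  **`outLaw_clip`** (`p̃(x) = min(p(x), M/N)/Z′` — "effectively reduces the probability of such
  outcomes to `c/2ⁿ`", renormalised), `one_sub_clipMass` (`1 − Z′ = Σ_{p > M/N} (p − M/N)`),
  **`tvDist_clip_le`** (`½ Σ |p − p̃| ≤ 1 − Z′`), `tvDist_clip_le_tailMass`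
  (`≤ ε − (M/N)·#{p > M/N}`), **`tvDist_clip_le_tvDist_skip`** (Algorithm 2's error never exceeds
  Algorithm 1's: "To further decrease `ε`"), `tvDist_clip_le_of_tailMass_le` (the form the rows use:
  tail weight `≤ ε` ⇒ TVD `≤ ε`), `acceptRate_skip_le_acceptRate_clip` and **`roundsMean_clip_le`**
  (mean number of probabilities per accepted string `M/Z′ ≤ M/(1 − ε)`: "using only `10ℓ` output
  probabilities" up to the factor `1/(1 − ε)`); the generic lemma behind it, `tvDist_normalize_le`
  (renormalising a sub-probability vector `m ≤ p` of mass `Z` moves it by at most `1 − Z` in TVD).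
* Batches (Villalonga's fast sampling): `accept_within` — `Σ_{k<n} α(1−α)ᵏ = 1 − (1−α)ⁿ`, the
  probability that `n` independent trials of success probability `α` contain an acceptance;
  `accept_within_batch_numerics` — `1 − 0.9³⁰ = 0.9576…`, `1 − 0.9⁶⁰ = 0.9982…` as printed.

## Reading notes / not here

(i) The Porter–Thomas displays of the source are EXPECTATIONS over an ensemble in which the `N p(x)`
are exponentially distributed; here they appear only as the two integrals actually printed
(`pt_tailCount`, `pt_tailMass`) — the modelling step "ensemble average = that integral" is the
source's hypothesis and is not asserted.  (ii) Algorithm 2's printed value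
`½ Σ |p − p̃| = 2 exp(−M′/(1 − e^{−M′}))` (repeated in [HangleiterEisert2023]) is not derived here;
only the distribution-free bounds above are.  Seat arithmetic (not a theorem of this file): for a
Porter–Thomas vector with `N = 2·10⁶` and `M′ = 3, 5, 10` the exact `½ Σ |p − p̃|` of `outLaw_clip`
evaluates to `0.0427, 0.00657, 4.6·10⁻⁵`, i.e. to `exp(−M′/(1 − e^{−M′}))`, one half of the printed
right-hand side — the printed `9·10⁻⁵` at `M′ = 10` is conservative by a factor `2` in that model.
(iii) Not here: McDiarmid's "`ℓ ± √(ℓM)` bitstrings", Metropolis sampling for boson sampling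
("`∼ 100` probabilities"), correlations inside a batch, any statement about approximate
probabilities or about the cost of computing `p(x)`.
Searched `lean search 'rejection'`: the tree's `RejectionSampling.lean` is Aaronson–Arkhipov's
Lemma 5.7 (ratio-bounded proposal, exact conditional law) and `GaussianRejectionSampler.lean` the
discrete-Gaussian sampler; neither has the budgeted (`min 1`) rule or its total-variation cost.
-/

noncomputable section

open Finset Real MeasureTheory Set Filter Topology

namespace Literature.Computability.QuantumComplexity.FrugalRejection

open Literature.Probability.MarkovChains

variable {S : Type*} [Fintype S]


/-! ## The sampler: acceptance rules, one round, the law of the accepted string -/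

/-- Algorithm 2's acceptance probability `min(1, p(x)N/M)` ("always accept `x_j` when
`p(x_j) ≥ M′/N`"); for `M ≥ N max p` it is the basic rule `p(x)N/M ≤ 1`.
[cite: MarkovEtAl2018, §4 ¶"Frugal rejection sampling" (Algorithm 2)]
[cite: VillalongaEtAl2019, §4.3.2 ("we accept a bit-string with probability min[1, p N/M]")] -/
def clipAccept (M : ℝ) (p : S → ℝ) (x : S) : ℝ := min 1 ((Fintype.card S : ℝ) * p x / M)

/-- Algorithm 1's acceptance probability with budget `M`: `p(x)N/M` when `N p(x) ≤ M`, and `0`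
("ignoring high-probability bitstrings") otherwise.
[cite: MarkovEtAl2018, §4 ¶"Basic rejection sampling" and ¶"Frugal rejection sampling" (Algorithm 1, Step 4)] -/
def skipAccept (M : ℝ) (p : S → ℝ) (x : S) : ℝ :=
  if (Fintype.card S : ℝ) * p x ≤ M then (Fintype.card S : ℝ) * p x / M else 0

/-- One round with acceptance rule `a`: the probability of proposing `x` (uniformly, `1/N`) AND
accepting it. [cite: MarkovEtAl2018, §4 ¶"Basic rejection sampling" ("select a bitstring uniformly at random … accept with probability …")] -/
def roundWeight (a : S → ℝ) (x : S) : ℝ := a x / (Fintype.card S : ℝ)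

/-- The probability that one round accepts, `α = Σ_x a(x)/N`.
[cite: MarkovEtAl2018, §4 ¶"Basic rejection sampling"] -/
def acceptRate (a : S → ℝ) : ℝ := ∑ x, roundWeight a x

/-- The law `p̃` of the accepted string ("repeating the entire process until acceptance"): the
one-round joint weight conditioned on acceptance. [cite: MarkovEtAl2018, §4 (the distribution `p̃(x)` from which Algorithm 1 / 2 samples)] -/
def outLaw (a : S → ℝ) (x : S) : ℝ := roundWeight a x / acceptRate a

/-- The weight of the upper tail above the budget, `Σ_{x : p(x) > M/N} p(x)` — the `ε` of the frugal
paragraph. [cite: MarkovEtAl2018, §4 ¶"Frugal rejection sampling" ("we set M′(ε) so that Σ_{x : p(x) > M′/N} p(x) ≤ ε")] -/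
def tailMass (M : ℝ) (p : S → ℝ) : ℝ :=
  ∑ x ∈ univ.filter (fun x => M < (Fintype.card S : ℝ) * p x), p x

/-- The number of strings above the budget, `#{x : p(x) > M/N}`.
[cite: MarkovEtAl2018, §4 ¶"Basic rejection sampling" ("the expected number ε of probabilities p(x) > M/N")] -/
def tailCount (M : ℝ) (p : S → ℝ) : ℕ :=
  (univ.filter (fun x => M < (Fintype.card S : ℝ) * p x)).card

/-- The clipped mass `Z′ = Σ_x min(p(x), M/N)` — the normalisation of Algorithm 2's law.
[cite: HangleiterEisert2023, classical-simulation section, sampling ¶ ("effectively reduces the probability of such outcomes to c/2ⁿ")] -/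
def clipMass (M : ℝ) (p : S → ℝ) : ℝ := ∑ x, min (p x) (M / (Fintype.card S : ℝ))

/-- An inhabited finite type has positive cardinality. [folklore] -/
private theorem card_pos_of_mem (x : S) : 0 < (Fintype.card S : ℝ) :=
  Nat.cast_pos.mpr (Fintype.card_pos_iff.mpr ⟨x⟩)

/-- A vector summing to `1` lives on a nonempty type. [folklore] -/
private theorem nonempty_of_sum_eq_one {p : S → ℝ} (hsum : ∑ x, p x = 1) : Nonempty S := by
  by_contra h; rw [not_nonempty_iff] at h; simp at hsum

/-- `α = (Σ_x a(x))/N`. [cite: MarkovEtAl2018, §4 ¶"Basic rejection sampling"] -/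
theorem acceptRate_eq (a : S → ℝ) : acceptRate a = (∑ x, a x) / (Fintype.card S : ℝ) := by
  unfold acceptRate roundWeight; rw [Finset.sum_div]

/-- The accepted string has law `a(x)/Σ_y a(y)`. [cite: HangleiterEisert2023, classical-simulation section, sampling ¶ (rejection sampling with the uniform proposal)] -/
theorem outLaw_eq (a : S → ℝ) (x : S) : outLaw a x = a x / ∑ y, a y := by
  unfold outLaw; rw [acceptRate_eq]; unfold roundWeight
  rw [div_div_div_cancel_right₀ (card_pos_of_mem x).ne']

/-- `p̃` is a probability vector (when some string can be accepted). [cite: MarkovEtAl2018, §4 (the distribution p̃)] -/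
theorem sum_outLaw {a : S → ℝ} (h : ∑ x, a x ≠ 0) : ∑ x, outLaw a x = 1 := by
  simp_rw [outLaw_eq, ← Finset.sum_div]; exact div_self h

/-- The number of rounds — of computed probabilities — until the first acceptance: with a round
accepting with probability `α ∈ (0,1]`, round `n+1` is the first success with probability
`α(1−α)ⁿ`, and `Σ_n (n+1) α (1−α)ⁿ = 1/α`. [cite: HangleiterEisert2023, classical-simulation section, sampling ¶ ("The expected number of probabilities that need to be computed per sample is given by c")] -/
theorem hasSum_rounds {α : ℝ} (h0 : 0 < α) (h1 : α ≤ 1) :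
    HasSum (fun n : ℕ => ((n : ℝ) + 1) * (α * (1 - α) ^ n)) (1 / α) := by
  have hr : ‖(1 - α : ℝ)‖ < 1 := by rw [Real.norm_eq_abs, abs_lt]; constructor <;> linarith
  have h1' := hasSum_coe_mul_geometric_of_norm_lt_one hr
  have h2' := hasSum_geometric_of_norm_lt_one hr
  have hs : (1 : ℝ) - (1 - α) = α := by ring
  rw [hs] at h1' h2'
  have h3 := (h1'.add h2').mul_left α
  have hα : α ≠ 0 := h0.ne'
  have hval : α * ((1 - α) / α ^ 2 + α⁻¹) = 1 / α := by
    field_simp; ring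
  rw [← hval]
  refine h3.congr_fun ?_
  intro n; ring

/-! ## Basic rejection sampling (`M ≥ N max p`): exact law, `M` probabilities per sample -/

/-- Under the bound `N p(x) ≤ M` the acceptance probability is `p(x)N/M`.
[cite: MarkovEtAl2018, §4 ¶"Basic rejection sampling" ("accept x_j with probability p(x_j)N/M ≤ 1")] -/
theorem clipAccept_of_le {M : ℝ} (hM : 0 < M) {p : S → ℝ} {x : S}
    (h : (Fintype.card S : ℝ) * p x ≤ M) :
    clipAccept M p x = (Fintype.card S : ℝ) * p x / M := by
  unfold clipAccept; exact min_eq_right ((div_le_one hM).mpr h)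

/-- With `M ≥ max_x p(x) N` a round accepts with probability exactly `1/M`.
[cite: MarkovEtAl2018, §4 ¶"Basic rejection sampling" ("requires an average of M probabilities p(x) per accepted bitstring")] -/
theorem acceptRate_clip_basic {M : ℝ} (hM : 0 < M) {p : S → ℝ} (hsum : ∑ x, p x = 1)
    (hmax : ∀ x, (Fintype.card S : ℝ) * p x ≤ M) : acceptRate (clipAccept M p) = 1 / M := by
  have hne := nonempty_of_sum_eq_one hsum
  have hN : (0 : ℝ) < (Fintype.card S : ℝ) := Nat.cast_pos.mpr Fintype.card_pos
  rw [acceptRate_eq]; simp_rw [clipAccept_of_le hM (hmax _)]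
  rw [← Finset.sum_div, ← Finset.mul_sum, hsum]; field_simp

/-- **Basic rejection sampling is exact**: with `M ≥ max_x p(x) N` the accepted string has law `p`.
[cite: MarkovEtAl2018, §4 ¶"Basic rejection sampling"] -/
theorem outLaw_clip_basic {M : ℝ} (hM : 0 < M) {p : S → ℝ} (hsum : ∑ x, p x = 1)
    (hmax : ∀ x, (Fintype.card S : ℝ) * p x ≤ M) : outLaw (clipAccept M p) = p := by
  funext x
  have hN := card_pos_of_mem x
  rw [outLaw_eq]; simp_rw [clipAccept_of_le hM (hmax _)]
  rw [← Finset.sum_div, ← Finset.mul_sum, hsum]; field_simp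

/-- "requires an average of `M` probabilities `p(x)` per accepted bitstring": with acceptance
probability `1/M` per round (`M ≥ 1`), the mean number of rounds is `M`.
[cite: MarkovEtAl2018, §4 ¶"Basic rejection sampling"] -/
theorem hasSum_rounds_basic {M : ℝ} (hM : 1 ≤ M) :
    HasSum (fun n : ℕ => ((n : ℝ) + 1) * (1 / M * (1 - 1 / M) ^ n)) M := by
  have h0 : 0 < 1 / M := by positivity
  have h1 : 1 / M ≤ 1 := (div_le_one (by linarith)).mpr hM
  simpa [one_div_one_div] using hasSum_rounds h0 h1

/-- The printed Porter–Thomas count of offending strings: `N ∫_M^∞ e^{−t} dt = N e^{−M}`.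
[cite: MarkovEtAl2018, §4 ¶"Basic rejection sampling", display "Exp[Σ_{p(x) ≥ M/N} 1] = ε = N∫_M^∞ e^{−t}dt = Ne^{−M}"] -/
theorem pt_tailCount (Nr M : ℝ) : Nr * ∫ t in Ioi M, exp (-t) = Nr * exp (-M) := by
  rw [integral_exp_neg_Ioi]

/-- "Hence for given `ε` we can choose `M = ln(N/ε)`": then `N e^{−M} = ε`.
[cite: MarkovEtAl2018, §4 ¶"Basic rejection sampling"] -/
theorem pt_tailCount_at_log {Nr ε : ℝ} (hN : 0 < Nr) (hε : 0 < ε) :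
    Nr * exp (-Real.log (Nr / ε)) = ε := by
  rw [Real.exp_neg, Real.exp_log (div_pos hN hε)]; field_simp

/-- `2.718 < e`. [folklore] -/
private theorem exp_one_gt_2718 : (2.718 : ℝ) < exp 1 := lt_trans (by norm_num) Real.exp_one_gt_d9

/-- `e < 2.7183`. [folklore] -/
private theorem exp_one_lt_27183 : exp 1 < (2.7183 : ℝ) := lt_trans Real.exp_one_lt_d9 (by norm_num)

/-- `eⁿ = (e¹)ⁿ`. [folklore] -/
private theorem exp_nat (n : ℕ) : exp (n : ℝ) = exp 1 ^ n := by
  rw [← Real.exp_nat_mul, mul_one]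

/-- "For `ε = 10⁻³` and `n = 49`, we need `M = ⌈ln(10³ 2⁴⁹)⌉ = 41` probabilities per bitstring."
[cite: MarkovEtAl2018, §4 ¶"Basic rejection sampling"]
[cite: HangleiterEisert2023, classical-simulation section, sampling ¶ ("for n = 49 up to error ε = 10⁻³ using 41 probabilities per bit string on average")] -/
theorem ceil_log_eq_41 : ⌈Real.log ((10 : ℝ) ^ 3 * 2 ^ 49)⌉ = 41 := by
  have hX : (0 : ℝ) < 10 ^ 3 * 2 ^ 49 := by positivity
  rw [Int.ceil_eq_iff]
  constructor
  · have h40 : ((41 : ℤ) : ℝ) - 1 = ((40 : ℕ) : ℝ) := by norm_num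
    rw [h40, Real.lt_log_iff_exp_lt hX, exp_nat]
    calc exp 1 ^ 40 < (2.7183 : ℝ) ^ 40 := by
          exact pow_lt_pow_left₀ exp_one_lt_27183 (exp_pos _).le (by norm_num)
      _ < 10 ^ 3 * 2 ^ 49 := by norm_num
  · have h41 : ((41 : ℤ) : ℝ) = ((41 : ℕ) : ℝ) := by norm_num
    rw [h41, Real.log_le_iff_le_exp hX, exp_nat]
    calc (10 : ℝ) ^ 3 * 2 ^ 49 ≤ (2.718 : ℝ) ^ 41 := by norm_num
      _ ≤ exp 1 ^ 41 := by
          exact pow_le_pow_left₀ (by norm_num) exp_one_gt_2718.le 41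

/-- … and with that budget the Porter–Thomas count is indeed `≤ ε`: `2⁴⁹ e^{−41} ≤ 10⁻³`.
[cite: MarkovEtAl2018, §4 ¶"Basic rejection sampling"] -/
theorem two_pow_49_mul_exp_neg_41_le : (2 : ℝ) ^ 49 * exp (-41) ≤ 10⁻¹ ^ 3 := by
  have h41 : exp (41 : ℝ) = exp 1 ^ 41 := by exact_mod_cast exp_nat 41
  rw [Real.exp_neg, h41]
  have hpos : (0 : ℝ) < exp 1 ^ 41 := by positivity
  rw [mul_inv_le_iff₀ hpos]
  calc (2 : ℝ) ^ 49 = 10⁻¹ ^ 3 * ((10 : ℝ) ^ 3 * 2 ^ 49) := by norm_num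
    _ ≤ 10⁻¹ ^ 3 * (2.718 : ℝ) ^ 41 := by gcongr; norm_num
    _ ≤ 10⁻¹ ^ 3 * exp 1 ^ 41 := by gcongr; exact exp_one_gt_2718.le

/-! ## The tail weight `ε = Σ_{p(x) > M/N} p(x)` -/

/-- `ε ≥ 0`. [cite: MarkovEtAl2018, §4 ¶"Frugal rejection sampling"] -/
theorem tailMass_nonneg {M : ℝ} {p : S → ℝ} (hp : ∀ x, 0 ≤ p x) : 0 ≤ tailMass M p :=
  Finset.sum_nonneg fun x _ => hp x

/-- `ε ≤ 1`. [cite: MarkovEtAl2018, §4 ¶"Frugal rejection sampling"] -/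
theorem tailMass_le_one {M : ℝ} {p : S → ℝ} (hp : ∀ x, 0 ≤ p x) (hsum : ∑ x, p x = 1) :
    tailMass M p ≤ 1 := by
  unfold tailMass; rw [← hsum]
  exact Finset.sum_le_sum_of_subset_of_nonneg (filter_subset _ _) fun x _ _ => hp x

/-- A larger budget can only shrink the tail weight. [cite: MarkovEtAl2018, §4 ¶"Frugal rejection sampling" ("The statistical distance decreases … with the number of probabilities M′")] -/
theorem tailMass_antitone {p : S → ℝ} (hp : ∀ x, 0 ≤ p x) {M M' : ℝ} (h : M ≤ M') :
    tailMass M' p ≤ tailMass M p := by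
  unfold tailMass
  exact Finset.sum_le_sum_of_subset_of_nonneg
    (fun x hx => by rw [mem_filter] at hx ⊢; exact ⟨hx.1, lt_of_le_of_lt h hx.2⟩)
    fun x _ _ => hp x

/-- The mass below the budget is `1 − ε`. [cite: MarkovEtAl2018, §4 ¶"Frugal rejection sampling"] -/
theorem sum_kept_eq {M : ℝ} {p : S → ℝ} (hsum : ∑ x, p x = 1) :
    ∑ x ∈ univ.filter (fun x => (Fintype.card S : ℝ) * p x ≤ M), p x = 1 - tailMass M p := by
  unfold tailMass
  have h := Finset.sum_filter_add_sum_filter_not univ (fun x => (Fintype.card S : ℝ) * p x ≤ M) p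
  have h' : univ.filter (fun x => ¬ (Fintype.card S : ℝ) * p x ≤ M) =
      univ.filter (fun x => M < (Fintype.card S : ℝ) * p x) :=
    Finset.filter_congr fun x _ => not_le
  rw [h', hsum] at h; linarith

/-- Estimating `ε` without Porter–Thomas: the average over a uniformly proposed `x` of
`N · p(x) · 1[p(x) > M/N]` is exactly `ε` — so "the sum of the probability amplitudes larger than
`M/N` … multiplied by `N` and divided by the number of amplitudes computed" is an unbiased estimate.
[cite: VillalongaEtAl2019, §4.3.3] [cite: MarkovEtAl2018, §4 ("can calculate the sampling error (for a given M′) for each batch of ℓM′ probability values")] -/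
theorem uniform_mean_tail_indicator (M : ℝ) (p : S → ℝ) :
    ∑ x, 1 / (Fintype.card S : ℝ) * ((Fintype.card S : ℝ) * if M < (Fintype.card S : ℝ) * p x then p x else 0) = tailMass M p := by
  rcases isEmpty_or_nonempty S with h | h
  · simp [tailMass]
  · have hN : (0 : ℝ) < (Fintype.card S : ℝ) := Nat.cast_pos.mpr Fintype.card_pos
    unfold tailMass
    rw [Finset.sum_filter]
    exact Finset.sum_congr rfl fun x _ => by field_simp

/-! ## Algorithm 1 (reject above the budget): law and exact total-variation cost -/

/-- Below the budget Algorithm 1 accepts with probability `p(x)N/M`. [cite: MarkovEtAl2018, §4 (Algorithm 1)] -/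
theorem skipAccept_of_le {M : ℝ} {p : S → ℝ} {x : S} (h : (Fintype.card S : ℝ) * p x ≤ M) :
    skipAccept M p x = (Fintype.card S : ℝ) * p x / M := if_pos h

/-- Above the budget Algorithm 1 rejects. [cite: MarkovEtAl2018, §4 (Algorithm 1, Step 4: "ignoring high-probability bitstrings")] -/
theorem skipAccept_of_lt {M : ℝ} {p : S → ℝ} {x : S} (h : M < (Fintype.card S : ℝ) * p x) :
    skipAccept M p x = 0 := if_neg (not_le.mpr h)

/-- `Σ_x a₁(x) = N(1 − ε)/M`. [cite: MarkovEtAl2018, §4 (Algorithm 1)] -/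
theorem sum_skipAccept {M : ℝ} {p : S → ℝ} (hsum : ∑ x, p x = 1) :
    ∑ x, skipAccept M p x = (Fintype.card S : ℝ) * (1 - tailMass M p) / M := by
  unfold skipAccept
  rw [Finset.sum_ite, Finset.sum_const_zero, add_zero, ← Finset.sum_div, ← Finset.mul_sum,
    sum_kept_eq hsum]

/-- A round of Algorithm 1 accepts with probability `(1 − ε)/M`. [cite: MarkovEtAl2018, §4 (Algorithm 1)] -/
theorem acceptRate_skip {M : ℝ} {p : S → ℝ} (hsum : ∑ x, p x = 1) :
    acceptRate (skipAccept M p) = (1 - tailMass M p) / M := by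
  have hne := nonempty_of_sum_eq_one hsum
  have hN : (0 : ℝ) < (Fintype.card S : ℝ) := Nat.cast_pos.mpr Fintype.card_pos
  rw [acceptRate_eq, sum_skipAccept hsum]; field_simp

/-- The law of Algorithm 1's output: `p̃(x) = p(x)/(1 − ε)` below the budget, `0` above.
[cite: MarkovEtAl2018, §4 ¶"Frugal rejection sampling" ("The distribution p̃(x) from which Algorithm 1 samples")] -/
theorem outLaw_skip {M : ℝ} (hM : 0 < M) {p : S → ℝ} (hsum : ∑ x, p x = 1) (x : S) :
    outLaw (skipAccept M p) x =
      if (Fintype.card S : ℝ) * p x ≤ M then p x / (1 - tailMass M p) else 0 := by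
  have hN := card_pos_of_mem x
  rw [outLaw_eq, sum_skipAccept hsum]
  unfold skipAccept
  split_ifs with h
  · rcases eq_or_ne (1 - tailMass M p) 0 with hz | hz
    · rw [hz]; simp
    · field_simp
  · simp

/-- **Algorithm 1's total-variation cost is exactly the tail weight**:
`½ Σ_x |p(x) − p̃(x)| = Σ_{x : p(x) > M/N} p(x)`, for every probability vector `p` whose tail weight
is `< 1`. [cite: MarkovEtAl2018, §4 ¶"Frugal rejection sampling", display "½Σ_x|p(x) − p̃(x)| = Exp[Σ_{x : p(x) > M′/N} p(x)] ≤ ε"] -/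
theorem tvDist_skip {M : ℝ} (hM : 0 < M) {p : S → ℝ} (hp : ∀ x, 0 ≤ p x) (hsum : ∑ x, p x = 1)
    (htail : tailMass M p < 1) :
    tvDist p (outLaw (skipAccept M p)) = tailMass M p := by
  set Z := 1 - tailMass M p with hZ
  have hZ0 : 0 < Z := by linarith
  have hZ1 : Z ≤ 1 := by linarith [tailMass_nonneg (M := M) hp]
  unfold tvDist
  have hterm : ∀ x, |p x - outLaw (skipAccept M p) x| =
      if (Fintype.card S : ℝ) * p x ≤ M then p x * (1 / Z - 1) else p x := by
    intro x
    rw [outLaw_skip hM hsum, ← hZ]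
    split_ifs with h
    · have h1 : p x ≤ p x / Z := by
        rw [le_div_iff₀ hZ0]; nlinarith [hp x]
      rw [abs_of_nonpos (by linarith)]; field_simp; ring
    · rw [sub_zero, abs_of_nonneg (hp x)]
  simp_rw [hterm]
  rw [Finset.sum_ite, ← Finset.sum_mul, sum_kept_eq hsum]
  have h' : univ.filter (fun x => ¬ (Fintype.card S : ℝ) * p x ≤ M) =
      univ.filter (fun x => M < (Fintype.card S : ℝ) * p x) :=
    Finset.filter_congr fun x _ => not_le
  rw [h']
  change 1 / 2 * (Z * (1 / Z - 1) + tailMass M p) = tailMass M p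
  field_simp; ring

/-- `d/dt [−(1 + t)e^{−t}] = t e^{−t}`. [folklore] -/
private theorem hasDerivAt_neg_one_add_mul_exp_neg (t : ℝ) :
    HasDerivAt (fun t : ℝ => -((1 + t) * exp (-t))) (t * exp (-t)) t := by
  have h1 : HasDerivAt (fun t : ℝ => 1 + t) 1 t := (hasDerivAt_id t).const_add 1
  have h2 : HasDerivAt (fun t : ℝ => exp (-t)) (exp (-t) * (-1)) t := (hasDerivAt_neg t).exp
  exact ((h1.fun_mul h2).fun_neg).congr_deriv (by ring)

/-- The printed Porter–Thomas value of the tail weight: `∫_{M′}^∞ t e^{−t} dt = (1 + M′) e^{−M′}`.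
[cite: MarkovEtAl2018, §4 ¶"Frugal rejection sampling", display "Exp[Σ_{x : p(x) > M′/N} p(x)] = ∫_{M′}^∞ t e^{−t} dt = e^{−M′}(1 + M′)"] -/
theorem pt_tailMass {M : ℝ} (hM : 0 ≤ M) : ∫ t in Ioi M, t * exp (-t) = (1 + M) * exp (-M) := by
  have hcont : ContinuousWithinAt (fun t : ℝ => -((1 + t) * exp (-t))) (Ici M) M :=
    (Continuous.continuousWithinAt (by fun_prop))
  have hlim : Tendsto (fun t : ℝ => -((1 + t) * exp (-t))) atTop (𝓝 0) := by
    have h1 := Real.tendsto_exp_neg_atTop_nhds_zero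
    have h2 := Real.tendsto_pow_mul_exp_neg_atTop_nhds_zero 1
    have h3 := (h1.add h2).neg
    simp only [pow_one, add_zero, neg_zero] at h3
    refine h3.congr' (Eventually.of_forall fun t => ?_); ring
  rw [integral_Ioi_of_hasDerivAt_of_nonneg hcont (fun t _ => hasDerivAt_neg_one_add_mul_exp_neg t)
    (fun t ht => mul_nonneg (hM.trans (le_of_lt ht)) (exp_pos _).le) hlim]
  ring

/-- "The statistical distance decreases exponentially with the number of probabilities `M′`":
`M′ ↦ (1 + M′) e^{−M′}` is non-increasing on `[0, ∞)`. [cite: MarkovEtAl2018, §4 ¶"Frugal rejection sampling"] -/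
theorem pt_tailMass_antitone : AntitoneOn (fun M : ℝ => (1 + M) * exp (-M)) (Ici 0) := by
  have hderiv : ∀ M : ℝ, HasDerivAt (fun M : ℝ => (1 + M) * exp (-M)) (-(M * exp (-M))) M := by
    intro M
    have h1 : HasDerivAt (fun t : ℝ => 1 + t) 1 M := (hasDerivAt_id M).const_add 1
    have h2 : HasDerivAt (fun t : ℝ => exp (-t)) (exp (-M) * (-1)) M := (hasDerivAt_neg M).exp
    exact (h1.fun_mul h2).congr_deriv (by ring)
  refine antitoneOn_of_deriv_nonpos (convex_Ici 0) (by fun_prop)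
    (fun M _ => (hderiv M).differentiableAt.differentiableWithinAt) fun M hM => ?_
  rw [interior_Ici] at hM
  rw [(hderiv M).deriv]
  have : 0 ≤ M * exp (-M) := mul_nonneg (le_of_lt hM) (exp_pos _).le
  linarith

/-- "`M′ = 10` gives statistical distance equal to `ε = 5·10⁻⁴`": `(1 + 10)e^{−10} ∈ (4.99·10⁻⁴, 5·10⁻⁴)`.
[cite: MarkovEtAl2018, §4 ¶"Frugal rejection sampling"] [cite: VillalongaEtAl2019, §4.3 ("M = 10 … statistical distance ε of the order of 10⁻⁴")] -/
theorem eleven_mul_exp_neg_ten :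
    (1 + 10) * exp (-10 : ℝ) < 5 / 10 ^ 4 ∧ 499 / 10 ^ 6 < (1 + 10) * exp (-10 : ℝ) := by
  have h10 : exp (10 : ℝ) = exp 1 ^ 10 := by exact_mod_cast exp_nat 10
  have hpos : (0 : ℝ) < exp 1 ^ 10 := by positivity
  rw [Real.exp_neg, h10]
  constructor
  · rw [mul_inv_lt_iff₀ hpos]
    calc (1 + 10 : ℝ) < 5 / 10 ^ 4 * (2.718 : ℝ) ^ 10 := by norm_num
      _ ≤ 5 / 10 ^ 4 * exp 1 ^ 10 := by gcongr; exact exp_one_gt_2718.le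
  · rw [lt_mul_inv_iff₀ hpos]
    calc 499 / 10 ^ 6 * exp 1 ^ 10 < 499 / 10 ^ 6 * (2.7183 : ℝ) ^ 10 := by
          gcongr; exact exp_one_lt_27183
      _ < 1 + 10 := by norm_num

/-! ## Algorithm 2 (accept above the budget): law and total-variation bounds -/

/-- Renormalising a sub-probability vector `0 ≤ m ≤ p` of mass `Z > 0` moves it by at most `1 − Z`
in total variation: `½ Σ |p − m/Z| ≤ 1 − Z`. [folklore] -/
private theorem tvDist_normalize_le {p m : S → ℝ} (hm0 : ∀ x, 0 ≤ m x) (hmp : ∀ x, m x ≤ p x)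
    (hsum : ∑ x, p x = 1) (hZ : 0 < ∑ x, m x) :
    tvDist p (fun x => m x / ∑ y, m y) ≤ 1 - ∑ x, m x := by
  classical
  set Z := ∑ y, m y with hZdef
  have hZ1 : Z ≤ 1 := hsum ▸ Finset.sum_le_sum fun x _ => hmp x
  have hmass : ∑ x, p x = ∑ x, m x / Z := by
    rw [← Finset.sum_div, div_self hZ.ne', hsum]
  rw [tvDist_eq_sum_filter hmass]
  calc ∑ x ∈ univ.filter (fun x => m x / Z ≤ p x), (p x - m x / Z)
      ≤ ∑ x ∈ univ.filter (fun x => m x / Z ≤ p x), (p x - m x) := by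
        refine Finset.sum_le_sum fun x _ => ?_
        have : m x ≤ m x / Z := by rw [le_div_iff₀ hZ]; nlinarith [hm0 x]
        linarith
    _ ≤ ∑ x, (p x - m x) :=
        Finset.sum_le_sum_of_subset_of_nonneg (filter_subset _ _) fun x _ _ => by linarith [hmp x]
    _ = 1 - Z := by rw [Finset.sum_sub_distrib, hsum]

/-- `0 ≤ a₂(x)`. [cite: MarkovEtAl2018, §4 (Algorithm 2)] -/
theorem clipAccept_nonneg {M : ℝ} (hM : 0 ≤ M) {p : S → ℝ} (hp : ∀ x, 0 ≤ p x) (x : S) :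
    0 ≤ clipAccept M p x :=
  le_min zero_le_one (div_nonneg (mul_nonneg (Nat.cast_nonneg _) (hp x)) hM)

/-- `a₂(x) ≤ 1`. [cite: MarkovEtAl2018, §4 (Algorithm 2)] -/
theorem clipAccept_le_one (M : ℝ) (p : S → ℝ) (x : S) : clipAccept M p x ≤ 1 := min_le_left _ _

/-- `min(1, p(x)N/M) = (N/M) · min(p(x), M/N)`. [cite: HangleiterEisert2023, classical-simulation section, sampling ¶ ("effectively reduces the probability of such outcomes to c/2ⁿ")] -/
theorem clipAccept_eq {M : ℝ} (hM : 0 < M) (p : S → ℝ) (x : S) :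
    clipAccept M p x = (Fintype.card S : ℝ) * min (p x) (M / (Fintype.card S : ℝ)) / M := by
  have hN := card_pos_of_mem x
  unfold clipAccept
  rcases le_total (p x) (M / (Fintype.card S : ℝ)) with h | h
  · rw [min_eq_left h]
    have h' : (Fintype.card S : ℝ) * p x / M ≤ 1 := by
      rw [div_le_one hM]; calc (Fintype.card S : ℝ) * p x ≤ (Fintype.card S : ℝ) * (M / (Fintype.card S : ℝ)) := by gcongr
        _ = M := by field_simp
    rw [min_eq_right h']
  · rw [min_eq_right h]
    have h' : 1 ≤ (Fintype.card S : ℝ) * p x / M := by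
      rw [one_le_div hM]; calc M = (Fintype.card S : ℝ) * (M / (Fintype.card S : ℝ)) := by field_simp
        _ ≤ (Fintype.card S : ℝ) * p x := by gcongr
    rw [min_eq_left h']; field_simp

/-- `Σ_x a₂(x) = N Z′/M`. [cite: MarkovEtAl2018, §4 (Algorithm 2)] -/
theorem sum_clipAccept {M : ℝ} (hM : 0 < M) (p : S → ℝ) :
    ∑ x, clipAccept M p x = (Fintype.card S : ℝ) * clipMass M p / M := by
  unfold clipMass; simp_rw [clipAccept_eq hM]; rw [← Finset.sum_div, ← Finset.mul_sum]

/-- A round of Algorithm 2 accepts with probability `Z′/M`. [cite: MarkovEtAl2018, §4 (Algorithm 2)] -/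
theorem acceptRate_clip {M : ℝ} (hM : 0 < M) (p : S → ℝ) :
    acceptRate (clipAccept M p) = clipMass M p / M := by
  rcases isEmpty_or_nonempty S with h | h
  · simp [acceptRate, clipMass]
  · have hN : (0 : ℝ) < (Fintype.card S : ℝ) := Nat.cast_pos.mpr Fintype.card_pos
    rw [acceptRate_eq, sum_clipAccept hM]; field_simp

/-- **The law of Algorithm 2's output**: `p̃(x) = min(p(x), M/N)/Z′` — strings above the budget are
sampled "with a lower probability", the budget `M/N`, renormalised.
[cite: MarkovEtAl2018, §4 ¶"Frugal rejection sampling" ("instead of ignoring high-probability bitstrings, we sample them with a lower probability")]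
[cite: HangleiterEisert2023, classical-simulation section, sampling ¶ ("effectively reduces the probability of such outcomes to c/2ⁿ")] -/
theorem outLaw_clip {M : ℝ} (hM : 0 < M) (p : S → ℝ) (x : S) :
    outLaw (clipAccept M p) x = min (p x) (M / (Fintype.card S : ℝ)) / clipMass M p := by
  have hN := card_pos_of_mem x
  rw [outLaw_eq, sum_clipAccept hM, clipAccept_eq hM]
  rcases eq_or_ne (clipMass M p) 0 with hz | hz
  · rw [hz]; simp
  · field_simp

/-- The clipped-off mass: `1 − Z′ = Σ_{x : p(x) > M/N} (p(x) − M/N)`. [cite: HangleiterEisert2023, classical-simulation section, sampling ¶] -/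
theorem one_sub_clipMass {M : ℝ} {p : S → ℝ} (hsum : ∑ x, p x = 1) :
    1 - clipMass M p = ∑ x ∈ univ.filter (fun x => M < (Fintype.card S : ℝ) * p x), (p x - M / (Fintype.card S : ℝ)) := by
  unfold clipMass
  rw [← hsum, ← Finset.sum_sub_distrib]
  rw [← Finset.sum_filter_add_sum_filter_not univ (fun x => M < (Fintype.card S : ℝ) * p x)]
  have h0 : ∑ x ∈ univ.filter (fun x => ¬ M < (Fintype.card S : ℝ) * p x), (p x - min (p x) (M / (Fintype.card S : ℝ))) = 0 := by
    refine Finset.sum_eq_zero fun x hx => ?_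
    rw [mem_filter, not_lt] at hx
    have hN := card_pos_of_mem x
    have : p x ≤ M / (Fintype.card S : ℝ) := by rw [le_div_iff₀ hN]; linarith [hx.2]
    rw [min_eq_left this, sub_self]
  rw [h0, add_zero]
  refine Finset.sum_congr rfl fun x hx => ?_
  rw [mem_filter] at hx
  have hN := card_pos_of_mem x
  have : M / (Fintype.card S : ℝ) ≤ p x := by rw [div_le_iff₀ hN]; linarith [hx.2]
  rw [min_eq_right this]

/-- `1 − Z′ = ε − (M/N)·#{x : p(x) > M/N}`. [cite: HangleiterEisert2023, classical-simulation section, sampling ¶] -/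
theorem one_sub_clipMass_eq {M : ℝ} {p : S → ℝ} (hsum : ∑ x, p x = 1) :
    1 - clipMass M p = tailMass M p - M / (Fintype.card S : ℝ) * tailCount M p := by
  rw [one_sub_clipMass hsum, Finset.sum_sub_distrib, Finset.sum_const, nsmul_eq_mul]
  unfold tailMass tailCount; ring

/-- `1 − Z′ ≤ ε`. [cite: MarkovEtAl2018, §4 ¶"Frugal rejection sampling"] -/
theorem one_sub_clipMass_le_tailMass {M : ℝ} (hM : 0 ≤ M) {p : S → ℝ} (hsum : ∑ x, p x = 1) :
    1 - clipMass M p ≤ tailMass M p := by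
  rw [one_sub_clipMass_eq hsum]
  have : 0 ≤ M / (Fintype.card S : ℝ) * tailCount M p := by positivity
  linarith

/-- `Z′ ≤ 1`. [cite: MarkovEtAl2018, §4 (Algorithm 2)] -/
theorem clipMass_le_one {M : ℝ} {p : S → ℝ} (hsum : ∑ x, p x = 1) : clipMass M p ≤ 1 := by
  unfold clipMass; rw [← hsum]; exact Finset.sum_le_sum fun x _ => min_le_left _ _

/-- `Z′ > 0` for a probability vector and a positive budget. [cite: MarkovEtAl2018, §4 (Algorithm 2)] -/
theorem clipMass_pos {M : ℝ} (hM : 0 < M) {p : S → ℝ} (hp : ∀ x, 0 ≤ p x) (hsum : ∑ x, p x = 1) :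
    0 < clipMass M p := by
  obtain ⟨x, -, hx⟩ : ∃ x ∈ (univ : Finset S), 0 < p x := by
    by_contra h; push Not at h
    have : ∑ x, p x ≤ 0 := Finset.sum_nonpos h
    linarith
  have hN := card_pos_of_mem x
  unfold clipMass
  refine lt_of_lt_of_le ?_ (Finset.single_le_sum (fun y _ => le_min (hp y) (div_nonneg hM.le hN.le))
    (mem_univ x))
  exact lt_min hx (div_pos hM hN)

/-- **Algorithm 2's total-variation cost is at most the clipped-off mass**: `½ Σ |p − p̃| ≤ 1 − Z′`.
[cite: MarkovEtAl2018, §4 ¶"Frugal rejection sampling" (Algorithm 2: "To further decrease ε")] -/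
theorem tvDist_clip_le {M : ℝ} (hM : 0 < M) {p : S → ℝ} (hp : ∀ x, 0 ≤ p x) (hsum : ∑ x, p x = 1) :
    tvDist p (outLaw (clipAccept M p)) ≤ 1 - clipMass M p := by
  have hfun : outLaw (clipAccept M p) = fun x => min (p x) (M / (Fintype.card S : ℝ)) / ∑ y, min (p y) (M / (Fintype.card S : ℝ)) := by
    funext x; rw [outLaw_clip hM]; rfl
  rw [hfun]
  exact tvDist_normalize_le (fun x => le_min (hp x) (div_nonneg hM.le (Nat.cast_nonneg _)))
    (fun x => min_le_left _ _) hsum (clipMass_pos hM hp hsum)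

/-- `½ Σ |p − p̃| ≤ ε − (M/N)·#{x : p(x) > M/N}` for Algorithm 2. [cite: MarkovEtAl2018, §4 ¶"Frugal rejection sampling" (Algorithm 2)] -/
theorem tvDist_clip_le_tailMass {M : ℝ} (hM : 0 < M) {p : S → ℝ} (hp : ∀ x, 0 ≤ p x)
    (hsum : ∑ x, p x = 1) :
    tvDist p (outLaw (clipAccept M p)) ≤ tailMass M p - M / (Fintype.card S : ℝ) * tailCount M p :=
  (tvDist_clip_le hM hp hsum).trans (one_sub_clipMass_eq hsum).le

/-- **"To further decrease `ε` … always accept `x_j` when `p(x_j) ≥ M′/N`"**: Algorithm 2's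
total-variation cost never exceeds Algorithm 1's. [cite: MarkovEtAl2018, §4 ¶"Frugal rejection sampling"] -/
theorem tvDist_clip_le_tvDist_skip {M : ℝ} (hM : 0 < M) {p : S → ℝ} (hp : ∀ x, 0 ≤ p x)
    (hsum : ∑ x, p x = 1) (htail : tailMass M p < 1) :
    tvDist p (outLaw (clipAccept M p)) ≤ tvDist p (outLaw (skipAccept M p)) := by
  rw [tvDist_skip hM hp hsum htail]
  exact (tvDist_clip_le hM hp hsum).trans (one_sub_clipMass_le_tailMass hM.le hsum)

/-- The form in which the rows use it: if the tail above the budget weighs `≤ ε`, the sampled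
distribution is `ε`-close to `p` in total variation. [cite: MarkovEtAl2018, §4 ¶"Frugal rejection sampling" ("we set M′(ε) so that Σ_{x : p(x) > M′/N} p(x) ≤ ε")]
[cite: HangleiterEisert2023, classical-simulation section, sampling ¶ ("chooses c such that the upper tail … has fixed weight ε")] -/
theorem tvDist_clip_le_of_tailMass_le {M ε : ℝ} (hM : 0 < M) {p : S → ℝ} (hp : ∀ x, 0 ≤ p x)
    (hsum : ∑ x, p x = 1) (hε : tailMass M p ≤ ε) :
    tvDist p (outLaw (clipAccept M p)) ≤ ε :=
  ((tvDist_clip_le hM hp hsum).trans (one_sub_clipMass_le_tailMass hM.le hsum)).trans hε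

/-- Algorithm 2 "reduces the fraction of rejected strings" relative to Algorithm 1.
[cite: HangleiterEisert2023, classical-simulation section, sampling ¶] -/
theorem acceptRate_skip_le_acceptRate_clip {M : ℝ} (hM : 0 < M) {p : S → ℝ}
    (hsum : ∑ x, p x = 1) :
    acceptRate (skipAccept M p) ≤ acceptRate (clipAccept M p) := by
  rw [acceptRate_skip hsum, acceptRate_clip hM]
  gcongr
  linarith [one_sub_clipMass_le_tailMass hM.le hsum (p := p)]

/-- **Probabilities per sampled string**: the mean number of rounds of Algorithm 2, `1/α = M/Z′`,
is at most `M/(1 − ε)` — "yields `ℓ` bistrings … using only `10ℓ` output probabilities" at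
`M′ = 10`, up to the factor `1/(1 − ε)`. [cite: MarkovEtAl2018, §4 (first paragraph and ¶"Frugal rejection sampling")]
[cite: MorvanEtAl2024, SI App. G ("requires computing only about 10 probabilities per output bitstring sampled")] -/
theorem roundsMean_clip_le {M : ℝ} (hM : 0 < M) {p : S → ℝ}
    (hsum : ∑ x, p x = 1) (htail : tailMass M p < 1) :
    1 / acceptRate (clipAccept M p) ≤ M / (1 - tailMass M p) := by
  rw [acceptRate_clip hM, one_div_div]
  have h1 : 0 < 1 - tailMass M p := by linarith
  exact div_le_div_of_nonneg_left hM.le h1 (by linarith [one_sub_clipMass_le_tailMass hM.le hsum (p := p)])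

/-! ## Batches (Villalonga et al.'s fast sampling) -/

/-- The probability that `n` independent trials with success probability `α` contain a success:
`Σ_{k<n} α(1−α)ᵏ = 1 − (1−α)ⁿ` ("the probability that a bit-string is accepted from a batch is (on
average) `1 − (1 − 1/M)^{N_C}`"). [cite: VillalongaEtAl2019, §4.3.2] -/
theorem accept_within (α : ℝ) (n : ℕ) : ∑ k ∈ range n, α * (1 - α) ^ k = 1 - (1 - α) ^ n := by
  rw [← Finset.mul_sum]
  have h := geom_sum_mul_neg (1 - α) n
  rw [sub_sub_cancel] at h
  rw [mul_comm]; exact h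

/-- "For `M = 10` and `N_C = 30`, the probability of acceptance in a batch is `95.76%` … for `M = 10`
and `N_C = 60`, the probability goes up to `99.82%`". [cite: VillalongaEtAl2019, §4.3.2] -/
theorem accept_within_batch_numerics :
    |(1 - (1 - 1 / 10) ^ 30 : ℝ) - 9576 / 10 ^ 4| ≤ 1 / 10 ^ 5 ∧
    |(1 - (1 - 1 / 10) ^ 60 : ℝ) - 9982 / 10 ^ 4| ≤ 1 / 10 ^ 5 := by
  constructor <;> (rw [abs_le]; constructor <;> norm_num)

end Literature.Computability.QuantumComplexity.FrugalRejection
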